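import Literature.MathematicalPhysics.QuantumFieldTheory.ConformalBootstrap3D.HRCoeffIntervalBounds
import Literature.MathematicalPhysics.QuantumFieldTheory.ConformalBootstrap3D.MixedBlockCoefficients

/-!
# `Δ`-cell bounds for the equal-parameter Dolan–Osborn coefficients `A_{n,j}(c,c;Δ,ℓ)`

The `εσσε` channel of the mixed `σ–ε` system (`gpm = g^{-Δ_σε,Δ_σε}`) has the `z`-series array
`A_{n,j}(c,c;Δ,ℓ)` (`hrCoeffAB c c Δ ℓ n j`, `c = (Δ_σ-Δ_ε)/2`), whose recursion weights are
`γ⁺_{E,j}(c,c) = (E+j+2c)²(j+1)/(2j+1) = γ⁺_{E+2c,j}` and `γ⁻_{E,j}(c,c) = (E-j-1+2c)² j/(2j+1) =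
γ⁻_{E+2c,j}` (`hrGammaPlusAB_self_eq`, `hrGammaMinusAB_self_eq`) — the Hogervorst–Rychkov weights at
the SHIFTED level `E + 2c`, with the UNSHIFTED pivot `C_{Δ+n+1,j} - C_{Δ,ℓ}`. Hence the interval
recursion of `HRCoeffIntervalBounds` runs verbatim with the `γ`-enclosures evaluated on
`[Δ₁+n+2c₁, Δ₂+n+2c₂]` for `c ∈ [c₁, c₂]` (a box in `(Δ, c)`, i.e. in `(Δ, Δ_σ, Δ_ε)`): the tables
`hrCoeffABLo c₁ c₂ Δ₁ Δ₂ ℓ`, `hrCoeffABHi c₁ c₂ Δ₁ Δ₂ ℓ` satisfy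
`0 ≤ hrCoeffABLo ≤ A_{n,j}(c,c;Δ,ℓ) ≤ hrCoeffABHi` for `unitarityBound3D ℓ < Δ₁ ≤ Δ ≤ Δ₂`,
`c₁ ≤ c ≤ c₂` (`hrCoeffAB_self_mem_Icc_interval`). These are the coefficient enclosures the odd-sector
light-block cells of a mixed point certificate consume (head terms of the dominating evaluation
`𝔇[gpm]`, `MixedOddTail`). Finite rational computations for rational corners.
[cite: DolanOsborn2004, §3 eqs. (3.11)–(3.12)]
-/

noncomputable section

namespace Literature.MathematicalPhysics.QuantumFieldTheory.ConformalBootstrap3D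

open Finset Set

/-- `γ⁺_{E,j}(c,c) = γ⁺_{E+2c,j}`. [cite: DolanOsborn2004, §3 eq. (3.11)] -/
theorem hrGammaPlusAB_self_eq (c E : ℝ) (j : ℕ) :
    hrGammaPlusAB c c E j = hrGammaPlus (E + 2 * c) j := by
  unfold hrGammaPlusAB hrGammaPlus; ring

/-- `γ⁻_{E,j}(c,c) = γ⁻_{E+2c,j}`. [cite: DolanOsborn2004, §3 eq. (3.11)] -/
theorem hrGammaMinusAB_self_eq (c E : ℝ) (j : ℕ) :
    hrGammaMinusAB c c E j = hrGammaMinus (E + 2 * c) j := by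
  unfold hrGammaMinusAB hrGammaMinus; ring

/-! ### The two interval tables -/

/-- **Lower interval table** for `A_{n,j}(c,c;Δ,ℓ)`, `Δ ∈ [Δ₁, Δ₂]`, `c ∈ [c₁, c₂]`: the recursion
with the lower `γ`-enclosures on the shifted level range `[Δ₁+n+2c₁, Δ₂+n+2c₂]` and the pivot at
`Δ₂`; `0` off the descendant range. [cite: DolanOsborn2004, §3 eq. (3.12)] -/
noncomputable def hrCoeffABLo (c₁ c₂ Δ₁ Δ₂ : ℝ) (ℓ : ℕ) : ℕ → ℕ → ℝ
  | 0, j => if j = ℓ then 1 else 0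
  | n + 1, j =>
      if InDescendantRange ℓ (n + 1) j then
        ((if j = 0 then 0 else
            hrGammaPlusLo (Δ₁ + n + 2 * c₁) (Δ₂ + n + 2 * c₂) (j - 1) *
              hrCoeffABLo c₁ c₂ Δ₁ Δ₂ ℓ n (j - 1)) +
            hrGammaMinusLo (Δ₁ + n + 2 * c₁) (Δ₂ + n + 2 * c₂) (j + 1) *
              hrCoeffABLo c₁ c₂ Δ₁ Δ₂ ℓ n (j + 1)) /
          casimirPivot3D Δ₂ ℓ (n + 1) j
      else 0

/-- **Upper interval table** for `A_{n,j}(c,c;Δ,ℓ)`, `Δ ∈ [Δ₁, Δ₂]`, `c ∈ [c₁, c₂]`: upper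
`γ`-enclosures on the shifted range, pivot at `Δ₁`; `0` off the descendant range.
[cite: DolanOsborn2004, §3 eq. (3.12)] -/
noncomputable def hrCoeffABHi (c₁ c₂ Δ₁ Δ₂ : ℝ) (ℓ : ℕ) : ℕ → ℕ → ℝ
  | 0, j => if j = ℓ then 1 else 0
  | n + 1, j =>
      if InDescendantRange ℓ (n + 1) j then
        ((if j = 0 then 0 else
            hrGammaPlusHi (Δ₁ + n + 2 * c₁) (Δ₂ + n + 2 * c₂) (j - 1) *
              hrCoeffABHi c₁ c₂ Δ₁ Δ₂ ℓ n (j - 1)) +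
            hrGammaMinusHi (Δ₁ + n + 2 * c₁) (Δ₂ + n + 2 * c₂) (j + 1) *
              hrCoeffABHi c₁ c₂ Δ₁ Δ₂ ℓ n (j + 1)) /
          casimirPivot3D Δ₁ ℓ (n + 1) j
      else 0

/-- [folklore] -/
theorem hrCoeffABLo_zero (c₁ c₂ Δ₁ Δ₂ : ℝ) (ℓ j : ℕ) :
    hrCoeffABLo c₁ c₂ Δ₁ Δ₂ ℓ 0 j = if j = ℓ then 1 else 0 := by
  simp [hrCoeffABLo]

/-- [folklore] -/
theorem hrCoeffABHi_zero (c₁ c₂ Δ₁ Δ₂ : ℝ) (ℓ j : ℕ) :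
    hrCoeffABHi c₁ c₂ Δ₁ Δ₂ ℓ 0 j = if j = ℓ then 1 else 0 := by
  simp [hrCoeffABHi]

/-- [folklore] -/
theorem hrCoeffABLo_succ (c₁ c₂ Δ₁ Δ₂ : ℝ) (ℓ n j : ℕ) :
    hrCoeffABLo c₁ c₂ Δ₁ Δ₂ ℓ (n + 1) j =
      if InDescendantRange ℓ (n + 1) j then
        ((if j = 0 then 0 else
            hrGammaPlusLo (Δ₁ + n + 2 * c₁) (Δ₂ + n + 2 * c₂) (j - 1) *
              hrCoeffABLo c₁ c₂ Δ₁ Δ₂ ℓ n (j - 1)) +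
            hrGammaMinusLo (Δ₁ + n + 2 * c₁) (Δ₂ + n + 2 * c₂) (j + 1) *
              hrCoeffABLo c₁ c₂ Δ₁ Δ₂ ℓ n (j + 1)) /
          casimirPivot3D Δ₂ ℓ (n + 1) j
      else 0 := by
  rfl

/-- [folklore] -/
theorem hrCoeffABHi_succ (c₁ c₂ Δ₁ Δ₂ : ℝ) (ℓ n j : ℕ) :
    hrCoeffABHi c₁ c₂ Δ₁ Δ₂ ℓ (n + 1) j =
      if InDescendantRange ℓ (n + 1) j then
        ((if j = 0 then 0 else
            hrGammaPlusHi (Δ₁ + n + 2 * c₁) (Δ₂ + n + 2 * c₂) (j - 1) *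
              hrCoeffABHi c₁ c₂ Δ₁ Δ₂ ℓ n (j - 1)) +
            hrGammaMinusHi (Δ₁ + n + 2 * c₁) (Δ₂ + n + 2 * c₂) (j + 1) *
              hrCoeffABHi c₁ c₂ Δ₁ Δ₂ ℓ n (j + 1)) /
          casimirPivot3D Δ₁ ℓ (n + 1) j
      else 0 := by
  rfl

/-- **Interval recursion bounds for `A(c,c)`.** On `unitarityBound3D ℓ < Δ₁ ≤ Δ ≤ Δ₂`, `c₁ ≤ c ≤ c₂`,
for all `n, j`: `0 ≤ hrCoeffABLo ≤ A_{n,j}(c,c;Δ,ℓ) ≤ hrCoeffABHi`. Induction on the level exactly as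
`hrCoeff_mem_Icc_interval`, with the weights read at the shifted level `Δ + n + 2c ∈
[Δ₁+n+2c₁, Δ₂+n+2c₂]`. [cite: DolanOsborn2004, §3 eqs. (3.11)–(3.12)] -/
theorem hrCoeffAB_self_mem_Icc_interval {c₁ c c₂ Δ₁ Δ Δ₂ : ℝ} {ℓ : ℕ}
    (hℓ : unitarityBound3D ℓ < Δ₁) (h1 : Δ₁ ≤ Δ) (h2 : Δ ≤ Δ₂) (hc1 : c₁ ≤ c) (hc2 : c ≤ c₂) :
    ∀ n j : ℕ, 0 ≤ hrCoeffABLo c₁ c₂ Δ₁ Δ₂ ℓ n j ∧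
      hrCoeffABLo c₁ c₂ Δ₁ Δ₂ ℓ n j ≤ hrCoeffAB c c Δ ℓ n j ∧
      hrCoeffAB c c Δ ℓ n j ≤ hrCoeffABHi c₁ c₂ Δ₁ Δ₂ ℓ n j := by
  intro n
  induction n with
  | zero =>
    intro j
    rw [hrCoeffABLo_zero, hrCoeffABHi_zero]
    by_cases h : j = ℓ
    · subst h; simp
    · rw [hrCoeffAB_zero_of_ne c c Δ h, if_neg h]
      exact ⟨le_rfl, le_rfl, le_rfl⟩
  | succ n ih =>
    intro j
    by_cases hr : InDescendantRange ℓ (n + 1) j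
    · rw [hrCoeffABLo_succ, hrCoeffABHi_succ, if_pos hr, if_pos hr, hrCoeffAB_succ,
        hrGammaPlusAB_self_eq, hrGammaMinusAB_self_eq]
      have hpiv : 0 < casimirPivot3D Δ₁ ℓ (n + 1) j :=
        casimirPivot3D_pos hℓ (by omega) hr.1 hr.2.1 hr.2.2
      have hp1 := casimirPivot3D_mono h1 ℓ (n + 1) j
      have hp2 := casimirPivot3D_mono h2 ℓ (n + 1) j
      have hE1 : Δ₁ + (n : ℝ) + 2 * c₁ ≤ Δ + n + 2 * c := by linarith
      have hE2 : Δ + (n : ℝ) + 2 * c ≤ Δ₂ + n + 2 * c₂ := by linarith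
      -- the `γ⁺` parent term
      have hP : 0 ≤ (if j = 0 then (0 : ℝ) else
            hrGammaPlusLo (Δ₁ + n + 2 * c₁) (Δ₂ + n + 2 * c₂) (j - 1) *
              hrCoeffABLo c₁ c₂ Δ₁ Δ₂ ℓ n (j - 1)) ∧
          (if j = 0 then (0 : ℝ) else
            hrGammaPlusLo (Δ₁ + n + 2 * c₁) (Δ₂ + n + 2 * c₂) (j - 1) *
              hrCoeffABLo c₁ c₂ Δ₁ Δ₂ ℓ n (j - 1)) ≤
          (if j = 0 then (0 : ℝ) else
            hrGammaPlus (Δ + n + 2 * c) (j - 1) * hrCoeffAB c c Δ ℓ n (j - 1)) ∧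
          (if j = 0 then (0 : ℝ) else
            hrGammaPlus (Δ + n + 2 * c) (j - 1) * hrCoeffAB c c Δ ℓ n (j - 1)) ≤
          (if j = 0 then (0 : ℝ) else
            hrGammaPlusHi (Δ₁ + n + 2 * c₁) (Δ₂ + n + 2 * c₂) (j - 1) *
              hrCoeffABHi c₁ c₂ Δ₁ Δ₂ ℓ n (j - 1)) := by
        by_cases hj0 : j = 0
        · simp only [hj0, if_true]; exact ⟨le_rfl, le_rfl, le_rfl⟩
        · simp only [if_neg hj0]
          obtain ⟨hl0, hl, hh⟩ := ih (j - 1)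
          exact mul_sandwich (hrGammaPlusLo_nonneg _ _ _) (hrGammaPlusLo_le hE1 hE2 _)
            (hrGammaPlus_le_hi hE1 hE2 _) hl0 hl hh
      -- the `γ⁻` parent term
      obtain ⟨hm0, hm, hmh⟩ := ih (j + 1)
      have hM := mul_sandwich (hrGammaMinusLo_nonneg _ _ _)
        (hrGammaMinusLo_le hE1 hE2 (j + 1)) (hrGammaMinus_le_hi hE1 hE2 (j + 1)) hm0 hm hmh
      obtain ⟨hP0, hPl, hPh⟩ := hP
      obtain ⟨hM0, hMl, hMh⟩ := hM
      exact div_sandwich (add_nonneg hP0 hM0) (add_le_add hPl hMl) (add_le_add hPh hMh) hpiv hp1 hp2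
    · rw [hrCoeffABLo_succ, hrCoeffABHi_succ, if_neg hr, if_neg hr,
        hrCoeffAB_eq_zero_of_not_inDescendantRange c c Δ hr]
      exact ⟨le_rfl, le_rfl, le_rfl⟩

/-- The lower table is non-negative (on a consistent box). [cite: DolanOsborn2004, §3 eq. (3.12)] -/
theorem hrCoeffABLo_nonneg {c₁ c₂ Δ₁ Δ₂ : ℝ} {ℓ : ℕ} (hℓ : unitarityBound3D ℓ < Δ₁) (h12 : Δ₁ ≤ Δ₂)
    (hc : c₁ ≤ c₂) (n j : ℕ) : 0 ≤ hrCoeffABLo c₁ c₂ Δ₁ Δ₂ ℓ n j :=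
  (hrCoeffAB_self_mem_Icc_interval hℓ le_rfl h12 le_rfl hc n j).1

/-- **Interval cell bounds** as membership. [cite: DolanOsborn2004, §3 eqs. (3.11)–(3.12)] -/
theorem hrCoeffAB_self_mem_Icc_interval' {c₁ c c₂ Δ₁ Δ Δ₂ : ℝ} {ℓ : ℕ}
    (hℓ : unitarityBound3D ℓ < Δ₁) (h1 : Δ₁ ≤ Δ) (h2 : Δ ≤ Δ₂) (hc1 : c₁ ≤ c) (hc2 : c ≤ c₂)
    (n j : ℕ) :
    hrCoeffAB c c Δ ℓ n j ∈
      Set.Icc (hrCoeffABLo c₁ c₂ Δ₁ Δ₂ ℓ n j) (hrCoeffABHi c₁ c₂ Δ₁ Δ₂ ℓ n j) :=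
  ⟨(hrCoeffAB_self_mem_Icc_interval hℓ h1 h2 hc1 hc2 n j).2.1,
    (hrCoeffAB_self_mem_Icc_interval hℓ h1 h2 hc1 hc2 n j).2.2⟩

/-- Consistency with the single-correlator tables: at `c₁ = c₂ = 0` the AB tables are
`hrCoeffLo`/`hrCoeffHi`. [cite: HogervorstRychkov2013, §3 eq. (3.9)] -/
theorem hrCoeffABLo_zero_zero (Δ₁ Δ₂ : ℝ) (ℓ : ℕ) :
    ∀ n j : ℕ, hrCoeffABLo 0 0 Δ₁ Δ₂ ℓ n j = hrCoeffLo Δ₁ Δ₂ ℓ n j := by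
  intro n
  induction n with
  | zero => intro j; rw [hrCoeffABLo_zero, hrCoeffLo_zero]
  | succ n ih =>
    intro j
    rw [hrCoeffABLo_succ, hrCoeffLo_succ]
    simp only [mul_zero, add_zero, ih]

end Literature.MathematicalPhysics.QuantumFieldTheory.ConformalBootstrap3D
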